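import Literature.Computability.AlgebraicComplexity.TavenasHomogeneous
import Literature.Computability.AlgebraicComplexity.DepthReductionProofs

/-!
# Tavenas' depth reduction, homogeneous form — discharge of the named fact

Discharge (D-0014) of `Literature.Computability.AlgebraicComplexity.homProductDepthCircuitSize_two_le_of_isVPFamily`
(`TavenasHomogeneous.lean`): S. Tavenas, *Improved bounds for reduction to depth 4 and depth 3*,
Inform. and Comput. 240 (2015) 2–11, **Thm. 1** — "Let `f` be an `n`-variate polynomial computed
by a circuit of size `s` and of degree `d`. Then `f` is computed by a `ΣΠ^{[O(α)]}ΣΠ^{[β]}`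
circuit `C` of size `2^{O(√(d log(ds) log n))}` […]. Furthermore, if `f` is homogeneous, it will
be also the case for `C`." — in the tree's model: for a `VP` family of HOMOGENEOUS polynomials,
`homProductDepthCircuitSize 2 (f n) ≤ (n + 2) ^ (c ⌊√deg fₙ⌋ + c)` (homogeneous circuits of
product-depth `≤ 2`, size = number of gates; `HomogeneousCircuits.lean`).

Everything except homogeneity bookkeeping is already in the tree, in the discharge of the
non-homogeneous sibling `productDepthCircuitSize_two_le_of_isVPFamily`
(`DepthReductionProofs.lean`, algebraic core `GateQuotients.lean`): homogenization of a
straight-line program into a homogeneous circuit certificate (`SLP.homogenize`, Tavenas Prop. 2),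
the Valiant–Skyum–Berkowitz–Rackoff gate quotients and the `×`-balanced expansion of
Agrawal–Vinay iterated down to degree `t = ⌊√d⌋` (`HomCircuit.expand`, `inv_expand`,
`final_expand`; Tavenas §5–§6), the `ΣΠΣΠ` builder `sigmaPiCircuit` with its value, gate count
and product depth, and the final arithmetic `sizeBound_le`. This file adds:

* `HomCircuit.isHomogeneous_val`, `HomCircuit.isHomogeneous_quot`, `HomCircuit.isHomogeneous_aval`
  (Tavenas Lemma 2 and §5: in a homogeneous circuit every gate `[α]` computes a homogeneous
  polynomial of its formal degree, and so does every quotient gate `(α;β)`, of degree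
  `deg α − deg β`), by the rank inductions of `GateQuotients.lean`;
* `HomCircuit.exists_sum_prod_hom`, `SLP.exists_sum_prod_component_hom`: the iterated expansion
  with the extra information that every factor is HOMOGENEOUS of degree `≤ t` (the atoms of the
  expansion are gates and quotient gates);
* `gateValues_sigmaPiCircuit`, `isHomogeneousCircuit_sigmaPiCircuit`,
  `exists_hom_circuit_sum_prod`: the `ΣΠΣΠ` circuit `Σ_τ Π_π p τ π` is a homogeneous circuit
  (`ArithCircuit.IsHomogeneousCircuit`: every gate value is homogeneous) as soon as every piece
  `p τ π` and the total are homogeneous — its gate values are monomials, the pieces, products of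
  pieces, and the total (Tavenas §6, proof of Lemma 3, homogeneous case);
* `exists_hom_circuit_of_slp`: a HOMOGENEOUS value of degree `d` of a straight-line program is
  its own degree-`d` component, so ONE component expansion suffices (no sum over components),
  padded with the constant `1` (homogeneous of degree `0`); gate bound `sizeBound` as before;
* `homProductDepthCircuitSize_two_le` (every commutative semiring) and the discharge
  `Literature.Computability.AlgebraicComplexity.homProductDepthCircuitSize_two_le_of_isVPFamily_holds` (over `ℂ`).

As in the sibling, the exponent is reached in the Agrawal–Vinay/Koiran form `s^{O(√d)}`, which
for p-bounded `s, d` is the vendored `(n+2)^{c√d + c}`; the fan-in bounds of the printed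
conclusion are not part of the fact. Nothing is asserted beyond the fact as vendored.

## References

* S. Tavenas, *Improved bounds for reduction to depth 4 and depth 3*, Inform. and Comput. 240
  (2015) 2–11; MFCS 2013, LNCS 8087, 813–824 (arXiv:1304.5777): Thm. 1 (p. 5: "if `f` is
  homogeneous, it will be also the case for `C`"), Lemma 2 (§4), §5 (quotient gates), Lemma 3
  and its proof (§6).
* M. Agrawal, V. Vinay, *Arithmetic circuits: a chasm at depth four*, FOCS 2008, 67–75.
* L. G. Valiant, S. Skyum, S. Berkowitz, C. Rackoff, *Fast parallel computation of polynomials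
  using few processors*, SIAM J. Comput. 12 (1983) 641–644.
* M. Kumar, S. Saraf, *On the power of homogeneous depth 4 arithmetic circuits*, SIAM J. Comput.
  46 (2017) 336–387, §1 (homogeneous `ΣΠΣΠ` circuits).
-/

noncomputable section

open MvPolynomial

namespace Literature.Computability.AlgebraicComplexity.DepthReduction

universe u v w

/-! ## Homogeneity of gate values and gate quotients (Tavenas 2015, Lemma 2 and §5) -/

section Homogeneity

variable {k : Type u} {σ : Type v} [CommSemiring k]

/-- A list sum of homogeneous polynomials of one degree is homogeneous of that degree. [folklore] -/
theorem isHomogeneous_list_sum {l : List (MvPolynomial σ k)} {n : ℕ}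
    (h : ∀ p ∈ l, p.IsHomogeneous n) : l.sum.IsHomogeneous n :=
  (homogeneousSubmodule σ k n).list_sum_mem h

/-- A scalar multiple of a homogeneous polynomial is homogeneous of the same degree. [folklore] -/
theorem isHomogeneous_smul {φ : MvPolynomial σ k} {n : ℕ} (c : k) (h : φ.IsHomogeneous n) :
    (c • φ).IsHomogeneous n :=
  (homogeneousSubmodule σ k n).smul_mem c h

end Homogeneity

namespace HomCircuit

variable {k : Type u} {σ : Type v} {ι : Type w} [CommSemiring k]
variable (H : HomCircuit k σ ι)

/-- Tavenas 2015, Lemma 2 (exact form): every gate of a homogeneous circuit computes a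
homogeneous polynomial of its formal degree — rank induction. [cite: Tavenas2015, §4, Lemma 2] -/
theorem isHomogeneous_val_aux : ∀ (n : ℕ) (ν : ι), H.rank ν = n →
    (H.val ν).IsHomogeneous (H.deg ν) := by
  intro n
  induction n using Nat.strong_induction_on with
  | _ n ih =>
    intro ν hn
    cases hkind : H.kind ν with
    | var j =>
      obtain ⟨h1, h2⟩ := H.wf_var ν j hkind
      rw [h1, h2]
      exact isHomogeneous_X k j
    | const c =>
      obtain ⟨h1, h2⟩ := H.wf_const ν c hkind
      rw [h1, h2]
      exact isHomogeneous_C σ c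
    | sum args =>
      obtain ⟨hargs, hv⟩ := H.wf_sum ν args hkind
      rw [hv]
      apply isHomogeneous_list_sum
      intro p hp
      obtain ⟨a, ha, rfl⟩ := List.mem_map.1 hp
      obtain ⟨hr, hd⟩ := hargs a ha
      exact isHomogeneous_smul a.1 (hd ▸ ih _ (hn ▸ hr) a.2 rfl)
    | prod a b =>
      obtain ⟨hra, hrb, hd, hv⟩ := H.wf_prod ν a b hkind
      rw [hv, hd]
      exact (ih _ (hn ▸ hra) a rfl).mul (ih _ (hn ▸ hrb) b rfl)

/-- **Tavenas 2015, Lemma 2**: in a homogeneous circuit every gate computes a homogeneous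
polynomial, of degree its formal degree (`val ν` is homogeneous of degree `deg ν`; the zero
polynomial is homogeneous of every degree). [cite: Tavenas2015, §4, Lemma 2] -/
theorem isHomogeneous_val (ν : ι) : (H.val ν).IsHomogeneous (H.deg ν) :=
  H.isHomogeneous_val_aux _ ν rfl

variable [DecidableEq ι]

/-- The gate quotient `[ν : μ]` is homogeneous of degree `deg ν - deg μ` (Tavenas 2015, §5:
"`(α;β)` is a homogeneous circuit of degree `deg α − deg β`"), rank induction; when
`deg ν < deg μ` the quotient is `0`. [cite: Tavenas2015, §5 (proof of Prop. 3)] -/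
theorem isHomogeneous_quot_aux (μ : ι) : ∀ (n : ℕ) (ν : ι), H.rank ν = n →
    (H.quot ν μ).IsHomogeneous (H.deg ν - H.deg μ) := by
  intro n
  induction n using Nat.strong_induction_on with
  | _ n ih =>
    intro ν hn
    by_cases hne : ν = μ
    · subst hne
      rw [quot_self, Nat.sub_self]
      exact isHomogeneous_one σ k
    cases hkind : H.kind ν with
    | var j =>
      rw [H.quot_var hkind hne]
      exact isHomogeneous_zero σ k _
    | const c =>
      rw [H.quot_const hkind hne]
      exact isHomogeneous_zero σ k _
    | sum args =>
      rw [H.quot_sum hkind hne]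
      apply isHomogeneous_list_sum
      intro p hp
      obtain ⟨a, ha, rfl⟩ := List.mem_map.1 hp
      obtain ⟨hr, hd⟩ := (H.wf_sum ν args hkind).1 a ha
      exact isHomogeneous_smul a.1 (hd ▸ ih _ (hn ▸ hr) a.2 rfl)
    | prod a b =>
      rw [H.quot_prod hkind hne]
      by_cases hlt : H.deg (H.heavy a b) < H.deg μ
      · rw [H.quot_eq_zero_of_deg_lt' hlt, mul_zero]
        exact isHomogeneous_zero σ k _
      · have h := (H.isHomogeneous_val (H.light a b)).mul
          (ih _ (hn ▸ H.rank_heavy_lt hkind) _ rfl)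
        have hdeg : H.deg (H.light a b) + (H.deg (H.heavy a b) - H.deg μ) =
            H.deg ν - H.deg μ := by
          rw [H.deg_prod_eq hkind]
          omega
        rwa [hdeg] at h

/-- The gate quotient `[ν : μ]` is a homogeneous polynomial of degree `deg ν - deg μ`
(Tavenas 2015, §5). [cite: Tavenas2015, §5 (proof of Prop. 3)] -/
theorem isHomogeneous_quot (ν μ : ι) : (H.quot ν μ).IsHomogeneous (H.deg ν - H.deg μ) :=
  H.isHomogeneous_quot_aux μ _ ν rfl

/-- Every atom of the expansion (a gate or a quotient gate) has a homogeneous value, of degree its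
formal degree. [cite: Tavenas2015, §5 (proof of Prop. 3)] -/
theorem isHomogeneous_aval (a : Atom ι) : (H.aval a).IsHomogeneous (H.adeg a) := by
  cases a with
  | node ν => exact H.isHomogeneous_val ν
  | quot ν μ => exact H.isHomogeneous_quot ν μ

variable [Fintype ι]

/-- **The iterated expansion, homogeneous form.** For a node `ν` of a homogeneous circuit
certificate on a finite node type of cardinality `S` and a threshold `t ≥ 1`, with
`R = 8 · deg ν / (t + 1)`: `val ν` is a sum of at most `(S²)^R` products of at most `1 + 4R`
HOMOGENEOUS polynomials of degree `≤ t` each (Tavenas 2015, Thm. 1 / Lemma 3, homogeneous case,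
in the Agrawal–Vinay expansion form: the factors are gates and quotient gates of the homogeneous
`×`-balanced circuit). [cite: Tavenas2015, Thm. 1 and Lemma 3; AgrawalVinay2008] -/
theorem exists_sum_prod_hom {t : ℕ} (ht : 1 ≤ t) (ν : ι) :
    ∃ L : List (List (MvPolynomial σ k)),
      (L.map List.prod).sum = H.val ν ∧
      L.length ≤ (Fintype.card ι * Fintype.card ι) ^ (8 * H.deg ν / (t + 1)) ∧
      ∀ T ∈ L, T.length ≤ 1 + 4 * (8 * H.deg ν / (t + 1)) ∧
        ∀ p ∈ T, ∃ e, e ≤ t ∧ p.IsHomogeneous e := by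
  haveI : Nonempty ι := ⟨ν⟩
  have hinv := H.inv_expand ht ν (8 * H.deg ν / (t + 1))
  refine ⟨(H.expand t ν (8 * H.deg ν / (t + 1))).map (List.map H.aval), ?_, ?_, ?_⟩
  · rw [← hinv.sum_eq, List.map_map]
    rfl
  · rw [List.length_map]
    exact hinv.card_le
  · intro T' hT'
    obtain ⟨T, hT, rfl⟩ := List.mem_map.1 hT'
    refine ⟨(List.length_map _).trans_le (hinv.length_le T hT), ?_⟩
    intro p hp
    obtain ⟨a, ha, rfl⟩ := List.mem_map.1 hp
    exact ⟨H.adeg a, H.final_expand ht ν T hT a ha, H.isHomogeneous_aval a⟩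

end HomCircuit

namespace SLP

variable {k : Type u} [CommSemiring k] {σ : Type v} (P : SLP k σ) (d : ℕ)

/-- Expansion of the homogenization, homogeneous form: the degree-`e` component (`e ≤ d`) of a
value of a straight-line program of length `L` is a sum of at most `(S·S)^{⌊8e/(t+1)⌋}` products
of at most `1 + 4⌊8e/(t+1)⌋` HOMOGENEOUS polynomials of degree `≤ t` each, `S = 4L(d+1)²`.
[cite: Tavenas2015, Thm. 1 (homogeneous case); AgrawalVinay2008] -/
theorem exists_sum_prod_component_hom {t : ℕ} (ht : 1 ≤ t) (i : Fin P.len) (e : Fin (d + 1)) :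
    ∃ L : List (List (MvPolynomial σ k)),
      (L.map List.prod).sum = homogeneousComponent e.val (P.val i.val) ∧
      L.length ≤
        ((4 * P.len * (d + 1) ^ 2) * (4 * P.len * (d + 1) ^ 2)) ^ (8 * e.val / (t + 1)) ∧
      ∀ T ∈ L, T.length ≤ 1 + 4 * (8 * e.val / (t + 1)) ∧
        ∀ p ∈ T, ∃ e', e' ≤ t ∧ p.IsHomogeneous e' := by
  classical
  obtain ⟨L, h1, h2, h3⟩ := (P.homogenize d).exists_sum_prod_hom ht (i, Tag.Q e)
  refine ⟨L, h1, h2.trans ?_, h3⟩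
  exact Nat.pow_le_pow_left (Nat.mul_le_mul (P.card_node_le d) (P.card_node_le d)) _

end SLP

/-! ## The `ΣΠΣΠ` circuit is homogeneous when its pieces and its value are -/

section Builder

variable {k : Type u} {σ : Type v} [CommSemiring k] [DecidableEq σ]
variable (T W : ℕ) (p : Fin T → Fin W → MvPolynomial σ k) (ms : List (σ →₀ ℕ))

open ArithCircuit

omit [DecidableEq σ] in
/-- The gate values of the `ΣΠΣΠ` circuit: those of its first three layers followed by the value
it computes (the output gate is the last gate). [folklore] -/
theorem gateValues_sigmaPiCircuit :
    gateValues (sigmaPiCircuit T W p ms).gates =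
      gateValues (layerM ms ++ layerP T W p ms ++ layerT T W ms) ++
        [(sigmaPiCircuit T W p ms).eval] := by
  have hlen : (gateValues (layerM ms ++ layerP T W p ms ++ layerT T W ms)).length =
      ms.length + T * W + T := by
    rw [gateValues_length, List.length_append, List.length_append, length_layerM, length_layerP,
      length_layerT]
  simp only [sigmaPiCircuit, ArithCircuit.eval, gateValues_append_singleton, Operand.eval,
    List.getD_eq_getElem?_getD]
  rw [List.getElem?_append_right hlen.le, hlen, Nat.sub_self]
  simp

/-- **Homogeneity of the `ΣΠΣΠ` circuit.** If every piece `p τ π` is homogeneous and the total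
`Σ_τ Π_π p τ π` is homogeneous, then every gate of `sigmaPiCircuit` computes a homogeneous
polynomial: the gate values are the monomials of `ms`, the pieces, the products `Π_π p τ π`, and
the total (Tavenas 2015, §6, proof of Lemma 3, homogeneous case; Kumar–Saraf 2017, §1).
[cite: Tavenas2015, §6 (proof of Lemma 3); KumarSaraf2017, §1] -/
theorem isHomogeneousCircuit_sigmaPiCircuit (hnd : ms.Nodup)
    (hp : ∀ τ π, (p τ π).support ⊆ ms.toFinset) (hhom : ∀ τ π, ∃ e, (p τ π).IsHomogeneous e)
    (hsum : ∃ e, (∑ τ : Fin T, ∏ π : Fin W, p τ π).IsHomogeneous e) :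
    (sigmaPiCircuit T W p ms).IsHomogeneousCircuit := by
  intro g hg
  rw [gateValues_sigmaPiCircuit, eval_sigmaPiCircuit T W p ms hnd hp,
    gateValues_layerMPT T W p ms hnd hp] at hg
  simp only [List.mem_append, List.mem_map, List.mem_singleton, List.mem_finRange,
    true_and] at hg
  rcases hg with ((⟨m, -, rfl⟩ | ⟨q, rfl⟩) | ⟨τ, rfl⟩) | rfl
  · exact ⟨_, isHomogeneous_monomial _ rfl⟩
  · exact hhom _ _
  · choose e he using hhom
    exact ⟨∑ π, e τ π, IsHomogeneous.prod _ _ _ fun π _ => he τ π⟩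
  · exact hsum

/-- **The homogeneous `ΣΠΣΠ` builder.** `Σ_{τ < T} Π_{π < W} p τ π`, with all supports inside a
finite set `U` of monomials, all pieces homogeneous and a homogeneous total, has a HOMOGENEOUS
unbounded-fan-in circuit of product-depth `≤ 2` with `#U + T · W + T + 1` gates.
[cite: Tavenas2015, §6, Lemma 3 (homogeneous case); LST2021, §1] -/
theorem exists_hom_circuit_sum_prod (U : Finset (σ →₀ ℕ)) (hp : ∀ τ π, (p τ π).support ⊆ U)
    (hhom : ∀ τ π, ∃ e, (p τ π).IsHomogeneous e)
    (hsum : ∃ e, (∑ τ : Fin T, ∏ π : Fin W, p τ π).IsHomogeneous e) :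
    ∃ C : ArithCircuit k σ, C.eval = ∑ τ : Fin T, ∏ π : Fin W, p τ π ∧ C.productDepth ≤ 2 ∧
      C.IsHomogeneousCircuit ∧ C.size = U.card + T * W + T + 1 := by
  refine ⟨sigmaPiCircuit T W p U.toList, ?_, productDepth_sigmaPiCircuit_le T W p _, ?_, ?_⟩
  · exact eval_sigmaPiCircuit T W p _ (Finset.nodup_toList U) (by simpa using hp)
  · exact isHomogeneousCircuit_sigmaPiCircuit T W p _ (Finset.nodup_toList U) (by simpa using hp)
      hhom hsum
  · rw [size_sigmaPiCircuit, Finset.length_toList]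

end Builder

/-! ## Assembly -/

section Assembly

variable {k : Type u} [CommSemiring k] {σ : Type v}

/-- A HOMOGENEOUS value of degree `d` of a straight-line program of length `s` over `N` variables
has a homogeneous product-depth-`2` circuit with at most `sizeBound N d s t` gates (`t ≥ 1`):
the value is its own degree-`d` component, whose expansion (`SLP.exists_sum_prod_component_hom`)
is fed, padded with the homogeneous constant `1`, to the homogeneous `ΣΠΣΠ` builder.
[cite: Tavenas2015, Thm. 1 and Lemma 3 (homogeneous case); AgrawalVinay2008] -/
theorem exists_hom_circuit_of_slp [Fintype σ] [DecidableEq σ] (S : SLP k σ) {i : ℕ}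
    (hi : i < S.len) {d t : ℕ} (hd : (S.val i).IsHomogeneous d) (ht : 1 ≤ t) :
    ∃ C : ArithCircuit k σ, C.eval = S.val i ∧ C.productDepth ≤ 2 ∧ C.IsHomogeneousCircuit ∧
      C.size ≤ sizeBound (Fintype.card σ) d S.len t := by
  obtain ⟨L, hsum, hlen, hT⟩ :=
    S.exists_sum_prod_component_hom d ht ⟨i, hi⟩ ⟨d, Nat.lt_succ_self d⟩
  have hsum' : (L.map List.prod).sum = S.val i := by
    rw [hsum]
    exact homogeneousComponent_eq_self hd
  set W := 1 + 4 * (8 * d / (t + 1)) with hW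
  let p : Fin L.length → Fin W → MvPolynomial σ k := fun τ π => (L[τ.val]).getD π.val 1
  let U : Finset (σ →₀ ℕ) := (Finset.univ : Finset (Fin L.length × Fin W)).biUnion
    fun x => (p x.1 x.2).support
  have hp : ∀ τ π, (p τ π).support ⊆ U := fun τ π =>
    Finset.subset_biUnion_of_mem (fun x : Fin L.length × Fin W => (p x.1 x.2).support)
      (Finset.mem_univ (τ, π))
  have hpτ : ∀ τ : Fin L.length, ∏ π : Fin W, p τ π = (L[τ.val]).prod := fun τ =>
    prod_getD_one _ W (hT _ (List.getElem_mem _)).1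
  have htot : ∑ τ : Fin L.length, ∏ π : Fin W, p τ π = S.val i := by
    rw [← hsum']
    simp only [hpτ]
    exact Fin.sum_univ_fun_getElem L List.prod
  have hhom : ∀ τ π, ∃ e, (p τ π).IsHomogeneous e := by
    intro τ π
    rcases getD_one_mem_or (L[τ.val]) π.val with h | h
    · obtain ⟨e, -, he⟩ := (hT _ (List.getElem_mem _)).2 _ h
      exact ⟨e, he⟩
    · refine ⟨0, ?_⟩
      simp only [p]
      rw [h]
      exact isHomogeneous_one σ k
  have hsumhom : ∃ e, (∑ τ : Fin L.length, ∏ π : Fin W, p τ π).IsHomogeneous e :=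
    ⟨d, htot ▸ hd⟩
  obtain ⟨C, hC, hpd, hhc, hsize⟩ := exists_hom_circuit_sum_prod L.length W p U hp hhom hsumhom
  refine ⟨C, hC.trans htot, hpd, hhc, ?_⟩
  rw [hsize, sizeBound]
  have hU : U.card ≤ (t + 1) * (Fintype.card σ + t) ^ t := by
    apply card_le_of_degree_le U ht
    intro m hm
    simp only [U, Finset.mem_biUnion, Finset.mem_univ, true_and] at hm
    obtain ⟨⟨τ, π⟩, hm⟩ := hm
    refine (le_totalDegree hm).trans ?_
    rcases getD_one_mem_or (L[τ.val]) π.val with h | h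
    · obtain ⟨e, he, hhe⟩ := (hT _ (List.getElem_mem _)).2 _ h
      exact hhe.totalDegree_le.trans he
    · simp only [p] at hm ⊢
      rw [h, totalDegree_one]
      exact Nat.zero_le _
  have hlen' : L.length ≤ (d + 1) * ((4 * S.len * (d + 1) ^ 2) *
      (4 * S.len * (d + 1) ^ 2)) ^ (8 * d / (t + 1)) :=
    hlen.trans (Nat.le_mul_of_pos_left _ (Nat.succ_pos d))
  have hLW : L.length * W ≤ ((d + 1) * ((4 * S.len * (d + 1) ^ 2) *
      (4 * S.len * (d + 1) ^ 2)) ^ (8 * d / (t + 1))) * W := Nat.mul_le_mul_right _ hlen'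
  rw [← hW]
  omega

/-- **Tavenas' depth reduction for `VP` families of homogeneous polynomials**, over any
commutative semiring: for a `VP` family `f` of homogeneous polynomials there is `c` with
`homProductDepthCircuitSize 2 (f n) ≤ (n + 2) ^ (c ⌊√deg fₙ⌋ + c)` for all `n` (Tavenas 2015,
Thm. 1, homogeneous case: "if `f` is homogeneous, it will be also the case for `C`"; via the
gate-quotient normal form of Valiant–Skyum–Berkowitz–Rackoff and the Agrawal–Vinay expansion).
[cite: Tavenas2015, Thm. 1; AgrawalVinay2008; ValiantSkyumBerkowitzRackoff1983] -/
theorem homProductDepthCircuitSize_two_le {σ : ℕ → Type v} [∀ n, Fintype (σ n)]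
    (f : ∀ n, MvPolynomial (σ n) k) (hf : IsVPFamily f)
    (hfhom : ∀ n, (f n).IsHomogeneous (f n).totalDegree) :
    ∃ c : ℕ, ∀ n : ℕ,
      homProductDepthCircuitSize 2 (f n) ≤
        ((n + 2 : ℕ∞) ^ (c * Nat.sqrt ((f n).totalDegree) + c)) := by
  classical
  obtain ⟨⟨⟨a1, h1⟩, ⟨a2, h2⟩⟩, ⟨a3, h3⟩⟩ := hf
  set a := a1 + a2 + a3 with ha
  set E := a + 2 with hE
  refine ⟨50 * E + 40, fun n => ?_⟩
  have hgh := hfhom n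
  set B := n + 2 with hB
  set g := f n with hg
  set d := g.totalDegree with hd
  set t := Nat.sqrt d with htd
  -- a homogeneous circuit of size ≤ B ^ ((48E+32) t + (50E+40))
  suffices hC : ∃ C : ArithCircuit k (σ n), C.eval = g ∧ C.productDepth ≤ 2 ∧
      C.IsHomogeneousCircuit ∧ C.size ≤ B ^ ((48 * E + 32) * t + (50 * E + 40)) by
    obtain ⟨C, hCe, hCd, hCh, hCs⟩ := hC
    refine (homProductDepthCircuitSize_le hCe hCd hCh).trans ?_
    have h50 : (48 * E + 32) * t + (50 * E + 40) ≤ (50 * E + 40) * t + (50 * E + 40) := by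
      nlinarith [Nat.zero_le E, Nat.zero_le t]
    have := hCs.trans (Nat.pow_le_pow_right (by omega) h50)
    calc (C.size : ℕ∞) ≤ ((B ^ ((50 * E + 40) * t + (50 * E + 40)) : ℕ) : ℕ∞) := by
          exact_mod_cast this
      _ = ((n + 2 : ℕ∞) ^ ((50 * E + 40) * t + (50 * E + 40))) := by push_cast [hB]; ring_nf
  have hBpos : 1 ≤ B ^ ((48 * E + 32) * t + (50 * E + 40)) := Nat.one_le_pow _ _ (by omega)
  by_cases hd0 : d = 0
  · refine ⟨ArithCircuit.ofConst (g.coeff 0), ?_, by rw [productDepth_ofConst]; norm_num,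
      ArithCircuit.isHomogeneousCircuit_ofConst _, ?_⟩
    · rw [ArithCircuit.eval_ofConst]; exact (totalDegree_eq_zero_iff_eq_C.1 hd0).symm
    · rw [ArithCircuit.size_ofConst]; exact Nat.zero_le _
  have ht : 1 ≤ t := by rw [htd, Nat.le_sqrt]; omega
  obtain ⟨P, hfan, hcomp, hsize⟩ := ArithCircuit.exists_computes_size_eq_complexity g
  obtain ⟨S, hlen, hcases⟩ := exists_slp P hfan
  rw [show P.eval = g from hcomp] at hcases
  rcases hcases with ⟨i, hi, hgi⟩ | ⟨j, hgj⟩ | ⟨c, hgc⟩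
  · have hdi : (S.val i).IsHomogeneous d := by rw [← hgi]; exact hgh
    obtain ⟨C, hCe, hCd, hCh, hCs⟩ := exists_hom_circuit_of_slp S hi hdi ht
    refine ⟨C, hCe.trans hgi.symm, hCd, hCh, hCs.trans ?_⟩
    have hN : Fintype.card (σ n) ≤ 2 * B ^ a := le_two_mul_pow (h1 n) (by omega)
    have hdd : d ≤ 2 * B ^ a := le_two_mul_pow (h2 n) (by omega)
    have hs : S.len ≤ 2 * B ^ a := by
      rw [hlen, hsize]; exact le_two_mul_pow (h3 n) (by omega)
    have h4 := four_mul_pow_le B a (by omega)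
    have htle : t ≤ d := Nat.sqrt_le_self d
    apply sizeBound_le (B := B) (E := E) (by omega)
    · rw [hE]; omega
    · rw [hE]; omega
    · rw [hE]; omega
    · rw [hE]; omega
    · exact Nat.lt_succ_sqrt d
  · refine ⟨ArithCircuit.ofVar j, ?_, by rw [productDepth_ofVar]; norm_num,
      ArithCircuit.isHomogeneousCircuit_ofVar _, ?_⟩
    · rw [ArithCircuit.eval_ofVar, hgj]
    · rw [ArithCircuit.size_ofVar]; exact Nat.zero_le _
  · refine ⟨ArithCircuit.ofConst c, ?_, by rw [productDepth_ofConst]; norm_num,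
      ArithCircuit.isHomogeneousCircuit_ofConst _, ?_⟩
    · rw [ArithCircuit.eval_ofConst, hgc]
    · rw [ArithCircuit.size_ofConst]; exact Nat.zero_le _

end Assembly

end Literature.Computability.AlgebraicComplexity.DepthReduction

/-- **Discharge** of the named fact `Literature.Computability.AlgebraicComplexity.homProductDepthCircuitSize_two_le_of_isVPFamily`
(Tavenas 2015, Thm. 1, homogeneous form, for `VP` families of homogeneous polynomials over `ℂ`).
[cite: Tavenas2015, Thm. 1; AgrawalVinay2008] -/
theorem Literature.Computability.AlgebraicComplexity.homProductDepthCircuitSize_two_le_of_isVPFamily_holds :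
    Literature.Computability.AlgebraicComplexity.homProductDepthCircuitSize_two_le_of_isVPFamily :=
  fun f hf hhom => Literature.Computability.AlgebraicComplexity.DepthReduction.homProductDepthCircuitSize_two_le f hf hhom

end
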